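import Literature.NumberTheory.GaloisRepresentations.HochschildSerreLowDegree
import HarnessLib

/-!
# The torsion-tolerant Hochschild–Serre edge `H¹(G/N, H¹(N, M)) → H²(G, M)`

Let `G` be a profinite group, `N ⊴ G` a closed normal subgroup and `M` a discrete `G`-module.  The
low-degree exact sequence of the Hochschild–Serre spectral sequence
`E₂^{pq} = H^p(G/N, H^q(N, M)) ⟹ H^{p+q}(G, M)` (Harari, *Galois Cohomology and Class Field Theory*,
Thm. 1.44 and Prop. A.66; Neukirch–Schmidt–Wingberg (2.1.4), (2.4.1))

  `… → H²(G/N, M^N) → Ker(H²(G, M) → H²(N, M)) → H¹(G/N, H¹(N, M)) → H³(G/N, M^N)`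

shows: if `H³(G/N, M^N) = 0` and `H²(G/N, M^N)` is killed by the integer `m`, then every class
`z ∈ E₂^{1,1} = H¹(G/N, H¹(N, M))` lifts to `H²(G, M)` up to an ambiguity killed by `m`, so that
`z ↦ m • (lift of z)` is a well-defined homomorphism `H¹(G/N, H¹(N, M)) → H²(G, M)` whose kernel is
killed by `m`.  The companion file `HochschildSerreEdge.lean` treats `m = 1` (`H²(G/N, M^N) = 0`:
an honest injection `hsEdge`).  The torsion-tolerant form is the one needed at the finite levels of
the proof of [AbsTopI] Thm. 2.6 (iii), second clause (S. Mochizuki, *Topics in Absolute Anabelian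
Geometry I*, p. 23: "`cd G = 2`, `δ²_l(G) = 0` ⟹ `H¹(G, H¹(Δ, ℚ_l)) ↪ H²(Π, ℚ_l)`"): for `G/N ≅ G_K`,
`K` a finite extension of `ℚ_p`, and `M = ℤ/lⁱ` with trivial action, `H²(G_K, ℤ/lⁱ) ≅ μ_{lⁱ}(K)^∨`
is NOT zero but is killed by `m = #μ_{l^∞}(K)` uniformly in `i`, while `H³(G_K, ℤ/lⁱ) = 0`.

Construction (dimension shifting, as in `HochschildSerreLowDegree` (HS2)): with the `G`- and
`N`-acyclic coinduced module `C = C(G, M)` and `Q = C/M` (`isSES_coind`), the connecting map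
`δ_N : Q^N ↠ H¹(N, M)` is a surjection of discrete `G/N`-modules (`deltaNHom`, `isSES_deltaNHom`)
with kernel `X` satisfying `Hⁱ(G/N, X) ↪ Hⁱ⁺¹(G/N, M^N)`; hence `H¹(δ_N) : H¹(G/N, Q^N) →
H¹(G/N, H¹(N, M))` is SURJECTIVE when `H³(G/N, M^N) = 0` and its KERNEL (the image of `H¹(G/N, X)`)
is killed by `m`; and `δ₁ ∘ Inf : H¹(G/N, Q^N) ↪ H¹(G, Q) ⥲ H²(G, M)` is injective.  The edge is
`hsEdgeTorsion z := m • δ₁ (Inf y)` for any `y` with `H¹(δ_N) y = z`.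

## Main results (namespace `Literature.NumberTheory.GaloisRepresentations`)

* generic, for a short exact sequence `0 → M₁ → M₂ → M₃ → 0` of discrete `G`-modules with
  `H¹(N, M₂) = 0`, `H¹(G/N, M₂^N) = H²(G/N, M₂^N) = 0`, `H³(G/N, M₁^N) = 0` and `m` killing
  `H²(G/N, M₁^N)`: `IsSES.nsmul_eq_zero_of_cohomologyMap_deltaNHom_eq_zero` (`ker H¹(δ_N)` is killed
  by `m`), `IsSES.hsEdgeTorsion`, `IsSES.hsEdgeTorsion_cohomologyMap_deltaNHom`
  (`hsEdgeTorsion (H¹(δ_N) y) = m • δ₁ (Inf y)`), `IsSES.nsmul_eq_zero_of_hsEdgeTorsion_eq_zero`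
  (needs moreover `H¹(G, M₂) = 0`);
* for a discrete `G`-module `M` (coinduced shift): **`hsEdgeTorsion N ρ m hm`** and
  **`nsmul_eq_zero_of_hsEdgeTorsion_eq_zero`**: `hsEdgeTorsion z = 0 ⟹ m • z = 0`;
  `mul_nsmul_eq_zero_of_nsmul_hsEdgeTorsion_eq_zero`: `n • hsEdgeTorsion z = 0 ⟹ (m * n) • z = 0`
  (so a class of order `lⁱ` has image of order `≥ lⁱ/m` when `m ∣ lᶜ`).

Classical, undisputed homological algebra; nothing here bears on [IUTchIII] Cor. 3.12 (the consumer
is the refereed [AbsTopI] Thm. 2.6 (iii) row of the abc-iut cell, layer L4: the finite levels of the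
injection `H¹(G_{H′}, Hom(R_l, ℚ_l)) ↪ H²(H′, ℚ_l)`).

## References
* D. Harari, *Galois Cohomology and Class Field Theory*, Universitext (2020), Thm. 1.44, Prop. A.66.
  [Harari2020]
* J. Neukirch, A. Schmidt, K. Wingberg, *Cohomology of Number Fields*, 2nd ed. (2008), (2.1.4),
  (2.4.1). [NeukirchSchmidtWingberg2008]
* S. Mochizuki, *Topics in Absolute Anabelian Geometry I: Generalities*, J. Math. Sci. Univ. Tokyo 19
  (2012), proof of Thm. 2.6 (iii), p. 23. [MochizukiAbsTopI2012]
-/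

noncomputable section

open CategoryTheory ContinuousCohomology Function

universe u

/-! ### The torsion-tolerant edge -/

namespace Literature.NumberTheory.GaloisRepresentations

open _root_.TopRep _root_.Topology _root_.Filter

variable {G : Type u} [Group G] [TopologicalSpace G] [IsTopologicalGroup G] [CompactSpace G] [T2Space G]
  [TotallyDisconnectedSpace G]
variable (N : Subgroup G) [N.Normal] [hN : IsClosed (N : Set G)]

namespace IsSES

variable {M₁ : Type u} [AddCommGroup M₁] [TopologicalSpace M₁] [DiscreteTopology M₁]
variable {M₂ : Type u} [AddCommGroup M₂] [TopologicalSpace M₂] [DiscreteTopology M₂]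
variable {M₃ : Type u} [AddCommGroup M₃] [TopologicalSpace M₃] [DiscreteTopology M₃]
variable {ρ₁ : ContinuousRep G ℤ M₁} {ρ₂ : ContinuousRep G ℤ M₂} {ρ₃ : ContinuousRep G ℤ M₃}
variable {f : ρ₁.toTopRep ⟶ ρ₂.toTopRep} {g : ρ₂.toTopRep ⟶ ρ₃.toTopRep}

omit [T2Space G] in
/-- **The kernel of `H¹(δ_N) : H¹(G/N, M₃^N) → H¹(G/N, H¹(N, M₁))` is killed by every `m` killing
`H²(G/N, M₁^N)`** (when `H¹(N, M₂) = 0` and `H¹(G/N, M₂^N) = 0`): the kernel is the image of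
`H¹(G/N, X)`, `X = ker δ_N`, and `δ : H¹(G/N, X) ↪ H²(G/N, M₁^N)` is injective.
[cite: Harari2020, Prop A.66] -/
theorem nsmul_eq_zero_of_cohomologyMap_deltaNHom_eq_zero (h : IsSES f g) (m : ℕ)
    (hm : ∀ x : continuousCohomology 2 (ρ₁.quotientInvariants N).toTopRep, m • x = 0)
    [Subsingleton (continuousCohomology 1 ((ρ₂.restrict (subgroupIncl N)).toTopRep))]
    [Subsingleton (continuousCohomology 1 (ρ₂.quotientInvariants N).toTopRep)]
    {y : continuousCohomology 1 (ρ₃.quotientInvariants N).toTopRep}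
    (hy : cohomologyMap (deltaNHom N h) 1 y = 0) : m • y = 0 := by
  have hXQT := isSES_deltaNHom N h
  obtain ⟨x, rfl⟩ := hXQT.exists_map_one_eq_of_map_one_eq_zero y hy
  have hx : m • x = 0 := by
    apply δ₁_injective_of_subsingleton (isSES_toIm N h)
    rw [map_nsmul, hm, map_zero]
  rw [← map_nsmul, hx, map_zero]

omit [T2Space G] in
/-- `H¹(δ_N)` is surjective when `H¹(N, M₂) = 0`, `H²(G/N, M₂^N) = 0` and `H³(G/N, M₁^N) = 0`
(restated pointwise for use below). [cite: Harari2020, Prop A.66] -/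
theorem exists_cohomologyMap_deltaNHom_eq (h : IsSES f g)
    [Subsingleton (continuousCohomology 1 ((ρ₂.restrict (subgroupIncl N)).toTopRep))]
    [Subsingleton (continuousCohomology 2 (ρ₂.quotientInvariants N).toTopRep)]
    [Subsingleton (continuousCohomology 3 (ρ₁.quotientInvariants N).toTopRep)]
    (z : continuousCohomology 1 (hOneRep N ρ₁).toTopRep) :
    ∃ y : continuousCohomology 1 (ρ₃.quotientInvariants N).toTopRep,
      cohomologyMap (deltaNHom N h) 1 y = z := by
  haveI := subsingleton_two_imRep N h
  exact (isSES_deltaNHom N h).exists_map_one_eq_of_δ₁_eq_zero z (Subsingleton.elim _ _)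

/-- A chosen preimage under `H¹(δ_N)` (any choice; the edge below does not depend on it up to the
`m`-torsion ambiguity it absorbs). [cite: Harari2020, Prop A.66] -/
def deltaNPreimage (h : IsSES f g)
    [Subsingleton (continuousCohomology 1 ((ρ₂.restrict (subgroupIncl N)).toTopRep))]
    [Subsingleton (continuousCohomology 2 (ρ₂.quotientInvariants N).toTopRep)]
    [Subsingleton (continuousCohomology 3 (ρ₁.quotientInvariants N).toTopRep)]
    (z : continuousCohomology 1 (hOneRep N ρ₁).toTopRep) :
    continuousCohomology 1 (ρ₃.quotientInvariants N).toTopRep :=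
  (h.exists_cohomologyMap_deltaNHom_eq N z).choose

omit [T2Space G] in
/-- The chosen preimage is a preimage. [cite: Harari2020, Prop A.66] -/
theorem cohomologyMap_deltaNHom_deltaNPreimage (h : IsSES f g)
    [Subsingleton (continuousCohomology 1 ((ρ₂.restrict (subgroupIncl N)).toTopRep))]
    [Subsingleton (continuousCohomology 2 (ρ₂.quotientInvariants N).toTopRep)]
    [Subsingleton (continuousCohomology 3 (ρ₁.quotientInvariants N).toTopRep)]
    (z : continuousCohomology 1 (hOneRep N ρ₁).toTopRep) :
    cohomologyMap (deltaNHom N h) 1 (h.deltaNPreimage N z) = z :=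
  (h.exists_cohomologyMap_deltaNHom_eq N z).choose_spec

/-- Two preimages under `H¹(δ_N)` of the same class give the same value `m • δ₁ (Inf y)`.
[cite: Harari2020, Prop A.66] -/
theorem nsmul_δ₁_infOne_eq_of_eq (h : IsSES f g) (m : ℕ)
    (hm : ∀ x : continuousCohomology 2 (ρ₁.quotientInvariants N).toTopRep, m • x = 0)
    [Subsingleton (continuousCohomology 1 ((ρ₂.restrict (subgroupIncl N)).toTopRep))]
    [Subsingleton (continuousCohomology 1 (ρ₂.quotientInvariants N).toTopRep)]
    {y y' : continuousCohomology 1 (ρ₃.quotientInvariants N).toTopRep}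
    (hyy : cohomologyMap (deltaNHom N h) 1 y = cohomologyMap (deltaNHom N h) 1 y') :
    m • h.δ₁ (infOne N ρ₃ y) = m • h.δ₁ (infOne N ρ₃ y') := by
  have hker : cohomologyMap (deltaNHom N h) 1 (y - y') = 0 := by rw [map_sub, hyy, sub_self]
  have hkill := h.nsmul_eq_zero_of_cohomologyMap_deltaNHom_eq_zero N m hm hker
  rw [smul_sub, sub_eq_zero] at hkill
  simp only [← map_nsmul]
  rw [hkill]

/-- **The torsion-tolerant edge `H¹(G/N, H¹(N, M₁)) →+ H²(G, M₁)`** of a dimension-shifting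
sequence: `z ↦ m • δ₁ (Inf y)` for any `y` with `H¹(δ_N) y = z`, where `m` kills `H²(G/N, M₁^N)`
(well defined: two preimages differ by an element of `ker H¹(δ_N)`, killed by `m`).  For `m = 1`
(`H²(G/N, M₁^N) = 0`) this is the edge `IsSES.hsEdge` of `HochschildSerreEdge.lean`.
[cite: Harari2020, Thm 1.44] -/
def hsEdgeTorsion (h : IsSES f g) (m : ℕ)
    (hm : ∀ x : continuousCohomology 2 (ρ₁.quotientInvariants N).toTopRep, m • x = 0)
    [Subsingleton (continuousCohomology 1 ((ρ₂.restrict (subgroupIncl N)).toTopRep))]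
    [Subsingleton (continuousCohomology 1 (ρ₂.quotientInvariants N).toTopRep)]
    [Subsingleton (continuousCohomology 2 (ρ₂.quotientInvariants N).toTopRep)]
    [Subsingleton (continuousCohomology 3 (ρ₁.quotientInvariants N).toTopRep)] :
    continuousCohomology 1 (hOneRep N ρ₁).toTopRep →+ continuousCohomology 2 ρ₁.toTopRep :=
  AddMonoidHom.mk' (fun z => m • h.δ₁ (infOne N ρ₃ (h.deltaNPreimage N z))) fun z z' => by
    have e : cohomologyMap (deltaNHom N h) 1 (h.deltaNPreimage N (z + z')) =
        cohomologyMap (deltaNHom N h) 1 (h.deltaNPreimage N z + h.deltaNPreimage N z') := by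
      rw [map_add, cohomologyMap_deltaNHom_deltaNPreimage, cohomologyMap_deltaNHom_deltaNPreimage,
        cohomologyMap_deltaNHom_deltaNPreimage]
    change m • h.δ₁ (infOne N ρ₃ (h.deltaNPreimage N (z + z'))) =
      m • h.δ₁ (infOne N ρ₃ (h.deltaNPreimage N z)) + m • h.δ₁ (infOne N ρ₃ (h.deltaNPreimage N z'))
    rw [h.nsmul_δ₁_infOne_eq_of_eq N m hm e, map_add, map_add, smul_add]

/-- **Characterisation of the torsion-tolerant edge**: `hsEdgeTorsion (H¹(δ_N) y) = m • δ₁ (Inf y)`.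
[cite: Harari2020, Thm 1.44] -/
theorem hsEdgeTorsion_cohomologyMap_deltaNHom (h : IsSES f g) (m : ℕ)
    (hm : ∀ x : continuousCohomology 2 (ρ₁.quotientInvariants N).toTopRep, m • x = 0)
    [Subsingleton (continuousCohomology 1 ((ρ₂.restrict (subgroupIncl N)).toTopRep))]
    [Subsingleton (continuousCohomology 1 (ρ₂.quotientInvariants N).toTopRep)]
    [Subsingleton (continuousCohomology 2 (ρ₂.quotientInvariants N).toTopRep)]
    [Subsingleton (continuousCohomology 3 (ρ₁.quotientInvariants N).toTopRep)]
    (y : continuousCohomology 1 (ρ₃.quotientInvariants N).toTopRep) :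
    h.hsEdgeTorsion N m hm (cohomologyMap (deltaNHom N h) 1 y) = m • h.δ₁ (infOne N ρ₃ y) :=
  h.nsmul_δ₁_infOne_eq_of_eq N m hm (h.cohomologyMap_deltaNHom_deltaNPreimage N _)

/-- Every value of the torsion-tolerant edge is `m • δ₁ (Inf y)` for a preimage `y`.
[cite: Harari2020, Thm 1.44] -/
theorem hsEdgeTorsion_apply (h : IsSES f g) (m : ℕ)
    (hm : ∀ x : continuousCohomology 2 (ρ₁.quotientInvariants N).toTopRep, m • x = 0)
    [Subsingleton (continuousCohomology 1 ((ρ₂.restrict (subgroupIncl N)).toTopRep))]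
    [Subsingleton (continuousCohomology 1 (ρ₂.quotientInvariants N).toTopRep)]
    [Subsingleton (continuousCohomology 2 (ρ₂.quotientInvariants N).toTopRep)]
    [Subsingleton (continuousCohomology 3 (ρ₁.quotientInvariants N).toTopRep)]
    (z : continuousCohomology 1 (hOneRep N ρ₁).toTopRep) :
    h.hsEdgeTorsion N m hm z = m • h.δ₁ (infOne N ρ₃ (h.deltaNPreimage N z)) := rfl

/-- **Injectivity up to `m`-torsion**: if moreover `H¹(G, M₂) = 0` (so that `δ₁ ∘ Inf` is injective),
`hsEdgeTorsion z = 0` forces `m • z = 0`. [cite: Harari2020, Prop A.66] -/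
theorem nsmul_eq_zero_of_hsEdgeTorsion_eq_zero (h : IsSES f g) (m : ℕ)
    (hm : ∀ x : continuousCohomology 2 (ρ₁.quotientInvariants N).toTopRep, m • x = 0)
    [Subsingleton (continuousCohomology 1 ρ₂.toTopRep)]
    [Subsingleton (continuousCohomology 1 ((ρ₂.restrict (subgroupIncl N)).toTopRep))]
    [Subsingleton (continuousCohomology 1 (ρ₂.quotientInvariants N).toTopRep)]
    [Subsingleton (continuousCohomology 2 (ρ₂.quotientInvariants N).toTopRep)]
    [Subsingleton (continuousCohomology 3 (ρ₁.quotientInvariants N).toTopRep)]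
    {z : continuousCohomology 1 (hOneRep N ρ₁).toTopRep} (hz : h.hsEdgeTorsion N m hm z = 0) :
    m • z = 0 := by
  rw [hsEdgeTorsion_apply, ← map_nsmul, ← map_nsmul] at hz
  have h1 : m • h.deltaNPreimage N z = 0 :=
    infOne_injective N ρ₃ (δ₁_injective_of_subsingleton h (by rw [hz, map_zero, map_zero]))
  rw [← h.cohomologyMap_deltaNHom_deltaNPreimage N z, ← map_nsmul, h1, map_zero]

end IsSES

/-! ### The torsion-tolerant edge for a discrete `G`-module, through the coinduced shift -/

variable {M : Type u} [AddCommGroup M] [TopologicalSpace M] [DiscreteTopology M]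
variable (ρ : ContinuousRep G ℤ M)

/-- **The torsion-tolerant Hochschild–Serre edge `H¹(G/N, H¹(N, M)) →+ H²(G, M)`** for a discrete
module `M` over a profinite group `G` and a closed normal subgroup `N`, when the natural number `m`
kills `H²(G/N, M^N)` and `H³(G/N, M^N) = 0`: `z ↦ m • δ₁ (Inf y)` (`H¹(δ_N) y = z`) through the shift
`0 → M → C(G, M) → Q → 0`.  (At `G/N ≅ G_K`, `K` a finite extension of `ℚ_p`, and `M = ℤ/lⁱ`
trivial: `H²(G_K, ℤ/lⁱ) ≅ μ_{lⁱ}(K)^∨` is killed by `m = #μ_{l^∞}(K)` uniformly in `i`, while it is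
not zero — whence this torsion-tolerant form of the edge of `HochschildSerreEdge.lean`.)
[cite: Harari2020, Thm 1.44] [cite: NeukirchSchmidtWingberg2008, (2.4.1)] -/
def hsEdgeTorsion (m : ℕ)
    (hm : ∀ x : continuousCohomology 2 (ρ.quotientInvariants N).toTopRep, m • x = 0)
    [Subsingleton (continuousCohomology 3 (ρ.quotientInvariants N).toTopRep)] :
    continuousCohomology 1 (hOneRep N ρ).toTopRep →+ continuousCohomology 2 ρ.toTopRep :=
  haveI := subsingleton_coind_restrict N ρ 0
  haveI := subsingleton_coind_invariants N ρ 0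
  haveI := subsingleton_coind_invariants N ρ 1
  (isSES_coind ρ).hsEdgeTorsion N m hm

/-- **Injectivity up to `m`-torsion of the torsion-tolerant edge**: `hsEdgeTorsion z = 0 ⟹ m • z = 0`
— so a class `z ∈ H¹(G/N, H¹(N, M))` of order not dividing `m` has NONZERO image in `H²(G, M)`, and
a class of order `n` has image of order `≥ n / gcd(n, m)`.  The step "`cd G_k = 2`, `δ²_l(G_k) = 0`
`⟹ H¹(G_k, H¹(Δ, –)) ↪ H²(Π, –)`" of [AbsTopI] Thm. 2.6 (iii) (p. 23) at the finite levels `ℤ/lⁱ`.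
[cite: Harari2020, Prop A.66] [cite: MochizukiAbsTopI2012, Thm 2.6 (iii) proof p.23] -/
theorem nsmul_eq_zero_of_hsEdgeTorsion_eq_zero (m : ℕ)
    (hm : ∀ x : continuousCohomology 2 (ρ.quotientInvariants N).toTopRep, m • x = 0)
    [Subsingleton (continuousCohomology 3 (ρ.quotientInvariants N).toTopRep)]
    {z : continuousCohomology 1 (hOneRep N ρ).toTopRep} (hz : hsEdgeTorsion N ρ m hm z = 0) :
    m • z = 0 := by
  haveI := subsingleton_coind ρ 0
  haveI := subsingleton_coind_restrict N ρ 0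
  haveI := subsingleton_coind_invariants N ρ 0
  haveI := subsingleton_coind_invariants N ρ 1
  exact (isSES_coind ρ).nsmul_eq_zero_of_hsEdgeTorsion_eq_zero N m hm hz

/-- Order form: the order of `hsEdgeTorsion z` is divisible by... more usefully, **if `n • hsEdgeTorsion z
= 0` then `(n * m) • z = 0`** (apply the previous theorem to `n • z`).
[cite: Harari2020, Prop A.66] -/
theorem mul_nsmul_eq_zero_of_nsmul_hsEdgeTorsion_eq_zero (m : ℕ)
    (hm : ∀ x : continuousCohomology 2 (ρ.quotientInvariants N).toTopRep, m • x = 0)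
    [Subsingleton (continuousCohomology 3 (ρ.quotientInvariants N).toTopRep)]
    {z : continuousCohomology 1 (hOneRep N ρ).toTopRep} {n : ℕ}
    (hz : n • hsEdgeTorsion N ρ m hm z = 0) : (m * n) • z = 0 := by
  rw [← map_nsmul] at hz
  rw [mul_smul]
  exact nsmul_eq_zero_of_hsEdgeTorsion_eq_zero N ρ m hm hz

end Literature.NumberTheory.GaloisRepresentations

end
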